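import Summits.AtomisticToContinuum.HydrodynamicLimit.Theorems.InformationPercolationEngineCollisionRateUnitMarkTruncation
import Summits.AtomisticToContinuum.HydrodynamicLimit.Theorems.InformationPercolationEngineCollisionRateCylinderPullbackUnit
import Summits.AtomisticToContinuum.HydrodynamicLimit.Theorems.InformationPercolationEngineCollisionRateContinuityCorrectionLG
import Summits.AtomisticToContinuum.HydrodynamicLimit.Theorems.InformationPercolationEngineCollisionRateCollisionMarkFluxLGOfEnvelope
import Summits.AtomisticToContinuum.HydrodynamicLimit.Theorems.InformationPercolationEngineCollisionRateFwdHitFluxLGOfEnvelope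
import Summits.AtomisticToContinuum.HydrodynamicLimit.Theorems.InformationPercolationEngineCollisionRateShortFlightDeficitLGOfFlux
import Summits.AtomisticToContinuum.HydrodynamicLimit.Theorems.InformationPercolationEngineCollisionRateThreeBodyCollisionSumLGOfEnvelope
import Summits.AtomisticToContinuum.HydrodynamicLimit.Theorems.InformationPercolationEngineCollisionMomentBoundOfFlux
import HarnessLib

/-!
# `InformationPercolationEngine.CollisionRate` (stmt-AtomisticToContinuum-13481) REDUCED to two statements about the evolved
# local Gibbs law: the marginal envelope (A) and two-body local equilibrium in `L¹` (T34)

Helper file (`--supports stmt-AtomisticToContinuum-13481`) of the crux line `Sketch` (card `hazard-fairness-compensator`; leads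
prover-line-stmt-AtomisticToContinuum-13481-0, -c1 … -c7; skeleton `Cruxes/CollisionRate/Lines/Sketch.lean` v23).  It lands in the
tree the line's kernel-checked COMPOSITION, so far only a crux workfile:

* `measure_lt_abs_setIntegral_flow_le_of_l1` — Markov for the time-integrated `L¹` norm along the flow: if `(t, z) ↦ A t z` is
  jointly measurable and bounded on `[0, τ] × Config` and `∫₀^τ E_P|A_t ∘ Φ_t| dt ≤ m` under a local Gibbs law `P`, then
  `P{η < |∫₀^τ A_t(Φ_t z) dt|} ≤ m/η`;
* `evenStatOne_of_marginalEnvelope_of_evenTubeStatL1` — the general composition at the speed-truncated unit mark `Ξ₁ᴸ`: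
  `evenStat(1) = [evenStat(1) − evenStat(Ξ₁ᴸ)] + [evenStat(Ξ₁ᴸ) − evenTubeTimeStat(Ξ₁ᴸ, κ)] + ∫₀^τ W_t ∘ Φ_t dt`, the three
  terms small in probability under the local Gibbs law by, respectively, the landed truncation T1 `stub_unitMarkTruncation`
  (`…CollisionRateUnitMarkTruncation.lean`), the landed Boltzmann-cylinder pull-back T2 = T2red `stub_cylinderPullbackUnit_of_residuals`
  ∘ (T2a `stub_continuityCorrectionLG`, T2b′ `stub_shortFlightDeficitLG_of_flux` ∘ (F2 `stub_collisionMarkFluxLG_of_envelope`, F3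
  `stub_fwdHitFluxLG_of_envelope`), T2c′ `stub_threeBodyCollisionSumLG_of_envelope`) — all from the marginal envelope (A) — and the
  Markov step on the hypothesis T34; the route's tail support `CollisionMomentBound` (stmt-15144), consumed by T1 and T2a, is itself
  derived from (A) through F2 (`Theorems.CollisionMomentBound.collisionMomentBound_of_collisionMarkFlux`); thresholds `η₀ := min`,
  `σ₀ := min ∧ 1/2`, accuracies `(η/3, δ/3)`, `L¹` budget `(η/3)(δ/3)`, `L := max L₀ 1`, `κ := min (κ₂/2) (κ₃/2)`, union bound;
* `stub_collisionRateReduction` — **`(A) → T34 → CollisionRate`** through the tree bridge `collisionRate_of_evenStat_one` (the crux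
  statistic is `evenStat` at the constant mark `1`); named and typed as the registered stub RED of the skeleton (v23).

The two hypotheses, stated verbatim as in the skeleton (no new definitions):
(A) MARGINAL ENVELOPE OF THE EVOLVED LAW — for continuous positive profiles, `σ < σ₀`, every flow family and `τ > 0` there are
`C ≥ 0`, a reference Maxwellian `N(u, θ)` and `N₀` such that for `N ≥ N₀`, `t ∈ [0, τ]` and distinct labels the two- and three-particle
labelled marginals of `LG_t = (Φ_t)_# LG` are dominated by `C × (Haar ⊗ N(u, θ))^{⊗k}` (`lintegral` form).  Lanford-type a-priori bound
at fixed reduced density; true at rung 0 and at `t = 0`; OPEN at `t > 0`.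
(T34) TWO-BODY LOCAL EQUILIBRIUM IN `L¹` — `∫₀^τ E_LG |W_t ∘ Φ_t| dt → 0` (`N → ∞` after `κ → 0`, fixed small `r`, `L ≥ 1`) for the
even tube functional `W_t = evenTubeStat` at `Ξ₁ᴸ`: the pre-collisional near-contact pair density of `LG_t` has the contact value
`Y(σ³ρ_r)` built from the configuration's own `r`-ball fields — the Boltzmann–Enskog rate hypothesis for the deterministic flow at
fixed `σ`, OPEN PROBLEM (its global-equilibrium instance is the theorem `stub_evenTubeStatL1Rung0`, `…EvenTubeStatL1Rung0.lean`).

So the crux is EXACTLY as hard as (A) ∧ T34; everything else in the line is a theorem.  Not here: any claim on (A) or T34.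

References: H. van Beijeren, M. H. Ernst, Physica 68 (1973) 437; P. Résibois, J. Stat. Phys. 19 (1978) 593; H. Spohn, *Large Scale
Dynamics of Interacting Particles* (1991), Part I §2.4, §3; C. Cercignani, R. Illner, M. Pulvirenti, *The Mathematical Theory of
Dilute Gases* (1994), §4.3.
-/

open scoped BigOperators Topology Classical MeasureTheory ProbabilityTheory InnerProductSpace ENNReal
open Filter Set Function MeasureTheory
open Literature.Analysis.FluidPDE Literature.MathematicalPhysics.KineticTheory

namespace Summit.AtomisticToContinuum.HydrodynamicLimit.Theorems.CollisionRate

open Summit.AtomisticToContinuum.HydrodynamicLimit.Theses.InformationPercolationEngine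

noncomputable section

/-- **Markov for the time-integrated `L¹` norm along the flow.**  If `(t, z) ↦ A t z` is jointly measurable with `|A| ≤ B` on
`[0, τ] × Config`, `P = localGibbsLaw …` is a probability measure and `∫₀^τ E_P|A_t ∘ Φ_t| dt ≤ m`, then
`P{η < |∫₀^τ A_t(Φ_t z) dt|} ≤ m/η` for `η > 0`. [folklore] -/
theorem measure_lt_abs_setIntegral_flow_le_of_l1 (σ : ℝ) (a₀ θ₀ : T3 → ℝ) (u₀ : T3 → V3) (N : ℕ)
    (Φ : HardSphereFlow (Torus.geometry (Fin 3)) (hsDiameter σ N) (N + 1))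
    [IsProbabilityMeasure (localGibbsLaw σ a₀ u₀ θ₀ N Φ)]
    {A : ℝ → Config (N + 1) (Fin 3) T3 → ℝ} {τ m η B : ℝ}
    (hmeas : Measurable fun p : ℝ × Config (N + 1) (Fin 3) T3 => A p.1 p.2)
    (hB : ∀ t ∈ Icc (0 : ℝ) τ, ∀ z : Config (N + 1) (Fin 3) T3, |A t z| ≤ B) (hτ : 0 < τ) (hη : 0 < η)
    (hl1 : ∫ t in Icc (0 : ℝ) τ, ∫ z, |A t (Φ.flow t z)| ∂(localGibbsLaw σ a₀ u₀ θ₀ N Φ) ≤ m) :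
    localGibbsLaw σ a₀ u₀ θ₀ N Φ {z | η < |∫ t in Icc (0 : ℝ) τ, A t (Φ.flow t z)|}
      ≤ ENNReal.ofReal (m / η) := by
  set P := localGibbsLaw σ a₀ u₀ θ₀ N Φ with hP
  -- `P`-a.e. configuration is good
  have hgood : ∀ᵐ z ∂P, z ∈ Φ.good := by
    rw [hP, localGibbsLaw_eq]
    exact (localGibbsMeasure_absolutelyContinuous σ a₀ u₀ θ₀ N Φ).ae_le Φ.ae_mem_good
  -- the globally defined, jointly measurable evaluation along the flow and its modulus
  set Y : ℝ × Config (N + 1) (Fin 3) T3 → ℝ := fun p => A p.1 (Φ.good.piecewise (Φ.flow p.1) id p.2) with hYdef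
  have hY : Measurable Y := hmeas.comp (measurable_fst.prodMk (measurable_piecewise_flow_torus Φ))
  have hYeq : ∀ z ∈ Φ.good, ∀ t, Y (t, z) = A t (Φ.flow t z) :=
    fun z hz t => by simp only [hYdef, piecewise_flow_of_mem Φ t hz]
  have hB0 : 0 ≤ B := (abs_nonneg _).trans (hB 0 ⟨le_rfl, hτ.le⟩ (Φ.flow 0 (fun _ => (0, 0))))
  have hYB : ∀ t ∈ Icc (0 : ℝ) τ, ∀ z, |Y (t, z)| ≤ B := fun t ht z => hB t ht _
  -- the lintegral majorant `F z = ∫⁻ₜ |Y(t,z)|`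
  set F : Config (N + 1) (Fin 3) T3 → ℝ≥0∞ := fun z => ∫⁻ t in Icc (0 : ℝ) τ, ENNReal.ofReal |Y (t, z)| with hFdef
  have hG : Measurable fun p : ℝ × Config (N + 1) (Fin 3) T3 => ENNReal.ofReal |Y p| :=
    (hY.abs).ennreal_ofReal
  have hFm : Measurable F := hG.lintegral_prod_left'
  -- on the good set the event is inside `{ofReal η ≤ F}`
  have hsub : ∀ z ∈ Φ.good, η < |∫ t in Icc (0 : ℝ) τ, A t (Φ.flow t z)| → ENNReal.ofReal η ≤ F z := by
    intro z hz h
    have hint : IntegrableOn (fun t => Y (t, z)) (Icc (0 : ℝ) τ) volume := by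
      refine Measure.integrableOn_of_bounded (M := B) measure_Icc_lt_top.ne
        ((hY.comp (measurable_id.prodMk measurable_const)).aestronglyMeasurable) ?_
      filter_upwards [ae_restrict_mem measurableSet_Icc] with t ht
      simpa only [Real.norm_eq_abs] using hYB t ht z
    have h1 : |∫ t in Icc (0 : ℝ) τ, A t (Φ.flow t z)| ≤ ∫ t in Icc (0 : ℝ) τ, |Y (t, z)| := by
      have : ∫ t in Icc (0 : ℝ) τ, A t (Φ.flow t z) = ∫ t in Icc (0 : ℝ) τ, Y (t, z) :=
        integral_congr_ae (ae_of_all _ fun t => (hYeq z hz t).symm)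
      rw [this]
      exact abs_integral_le_integral_abs
    have h2 : ENNReal.ofReal (∫ t in Icc (0 : ℝ) τ, |Y (t, z)|) = F z := by
      rw [hFdef, ofReal_integral_eq_lintegral_ofReal hint.abs (ae_of_all _ fun t => abs_nonneg _)]
    rw [← h2]
    exact ENNReal.ofReal_le_ofReal (h.le.trans h1)
  -- Tonelli: `∫ F dP = ∫ₜ ∫ |Y| dP ≤ ofReal m`
  have hTon : ∫⁻ z, F z ∂P ≤ ENNReal.ofReal m := by
    have hswap : ∫⁻ z, F z ∂P = ∫⁻ t in Icc (0 : ℝ) τ, ∫⁻ z, ENNReal.ofReal |Y (t, z)| ∂P := by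
      rw [hFdef]
      exact lintegral_lintegral_swap (hG.comp measurable_swap).aemeasurable
    rw [hswap]
    -- the fixed-time `L¹` norms as a function of time
    set gt : ℝ → ℝ := fun t => ∫ z, |Y (t, z)| ∂P with hgtdef
    have hgtm : StronglyMeasurable gt :=
      (hY.abs.stronglyMeasurable).integral_prod_right' (ν := P)
    have hgtB : ∀ t ∈ Icc (0 : ℝ) τ, ‖gt t‖ ≤ B := by
      intro t ht
      have h := norm_integral_le_of_norm_le_const (μ := P) (f := fun z => |Y (t, z)|) (C := B)
        (Eventually.of_forall fun z => by simpa only [Real.norm_eq_abs, abs_abs] using hYB t ht z)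
      simpa only [probReal_univ, mul_one] using h
    have hgtint : IntegrableOn gt (Icc (0 : ℝ) τ) volume :=
      Measure.integrableOn_of_bounded (M := B) measure_Icc_lt_top.ne hgtm.aestronglyMeasurable
        (by filter_upwards [ae_restrict_mem measurableSet_Icc] with t ht using hgtB t ht)
    have hgteq : ∀ t, ∫ z, |A t (Φ.flow t z)| ∂P = gt t := fun t =>
      integral_congr_ae (by
        filter_upwards [hgood] with z hz
        rw [hYeq z hz t])
    have hl1' : ∫ t in Icc (0 : ℝ) τ, gt t ≤ m := by
      have : ∫ t in Icc (0 : ℝ) τ, gt t = ∫ t in Icc (0 : ℝ) τ, ∫ z, |A t (Φ.flow t z)| ∂P :=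
        integral_congr_ae (ae_of_all _ fun t => (hgteq t).symm)
      rw [this]
      exact hl1
    -- inner integrals as Bochner integrals
    have hinner : ∀ t ∈ Icc (0 : ℝ) τ, ∫⁻ z, ENNReal.ofReal |Y (t, z)| ∂P = ENNReal.ofReal (gt t) := by
      intro t ht
      have hint : Integrable (fun z => |Y (t, z)|) P := by
        refine (integrable_const B).mono'
          ((hY.comp (measurable_const.prodMk measurable_id)).abs.aestronglyMeasurable) ?_
        exact ae_of_all _ fun z => by simpa only [Real.norm_eq_abs, abs_abs] using hYB t ht z
      rw [hgtdef, ofReal_integral_eq_lintegral_ofReal hint (ae_of_all _ fun z => abs_nonneg _)]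
    calc ∫⁻ t in Icc (0 : ℝ) τ, ∫⁻ z, ENNReal.ofReal |Y (t, z)| ∂P
        = ∫⁻ t in Icc (0 : ℝ) τ, ENNReal.ofReal (gt t) :=
          setLIntegral_congr_fun measurableSet_Icc fun t ht => hinner t ht
      _ = ENNReal.ofReal (∫ t in Icc (0 : ℝ) τ, gt t) :=
          (ofReal_integral_eq_lintegral_ofReal hgtint
            (ae_of_all _ fun t => integral_nonneg fun z => abs_nonneg _)).symm
      _ ≤ ENNReal.ofReal m := ENNReal.ofReal_le_ofReal hl1'
  have hη' : ENNReal.ofReal η ≠ 0 := by simpa using hη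
  calc P {z | η < |∫ t in Icc (0 : ℝ) τ, A t (Φ.flow t z)|}
      ≤ P {z | ENNReal.ofReal η ≤ F z} := by
        refine measure_mono_ae ?_
        filter_upwards [hgood] with z hz h
        exact hsub z hz h
    _ ≤ (∫⁻ z, F z ∂P) / ENNReal.ofReal η := meas_ge_le_lintegral_div hFm.aemeasurable hη' ENNReal.ofReal_ne_top
    _ ≤ ENNReal.ofReal m / ENNReal.ofReal η := ENNReal.div_le_div_right hTon _
    _ = ENNReal.ofReal (m / η) := by rw [ENNReal.ofReal_div_of_pos hη]

/-- **The general composition at the unit mark, `L¹` form, from (A) and T34.**  For the marginal envelope (A) of the evolved local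
Gibbs law and the time-integrated `L¹` smallness T34 of the even tube functional at `Ξ₁ᴸ` (both hypotheses, verbatim the line's
shapes `MarginalEnvelopeLG`, `EvenTubeStatL1LG`): `evenStat σ N Φ τ χ g 1 r` is small in `LG`-probability, `N → ∞` then `r → 0`.
Chain: F2, F3 from (A); `CollisionMomentBound` from F2; T2b from F2+F3; T2c from (A); T2a from CMB+T2b; T2 from T2a/T2b/T2c; T1
from CMB; T34 by Markov (`measure_lt_abs_setIntegral_flow_le_of_l1`, regularity `evenTubeStatRegular_one`); union bound with
accuracies `(η/3, δ/3)`. [folklore] -/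
theorem evenStatOne_of_marginalEnvelope_of_evenTubeStatL1
    (hA : ∀ (a₀ θ₀ : T3 → ℝ) (u₀ : T3 → V3), Continuous a₀ → Continuous θ₀ → Continuous u₀ →
      (∀ x, 0 < a₀ x) → (∀ x, 0 < θ₀ x) → ∃ σ₀ : ℝ, 0 < σ₀ ∧ ∀ σ : ℝ, 0 < σ → σ < σ₀ →
      ∀ Φ : (N : ℕ) → HardSphereFlow (Torus.geometry (Fin 3)) (hsDiameter σ N) (N + 1),
      ∀ τ : ℝ, 0 < τ → ∃ C : ℝ, 0 ≤ C ∧ ∃ u : V3, ∃ θ : ℝ, 0 < θ ∧ ∃ N₀ : ℕ, ∀ N : ℕ, N₀ ≤ N →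
      ∀ t ∈ Set.Icc (0 : ℝ) τ,
        (∀ i j : Fin (N + 1), i ≠ j → ∀ f : (T3 × V3) × (T3 × V3) → ℝ≥0∞, Measurable f →
          ∫⁻ z, f ((Φ N).flow t z i, (Φ N).flow t z j) ∂(localGibbsLaw σ a₀ u₀ θ₀ N (Φ N)) ≤
            ENNReal.ofReal C * ∫⁻ q, f q ∂(((volume : Measure T3).prod (gaussMeasure u θ)).prod
              ((volume : Measure T3).prod (gaussMeasure u θ)))) ∧
        (∀ i j k : Fin (N + 1), i ≠ j → i ≠ k → j ≠ k → ∀ f : (T3 × V3) × (T3 × V3) × (T3 × V3) → ℝ≥0∞, Measurable f →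
          ∫⁻ z, f ((Φ N).flow t z i, (Φ N).flow t z j, (Φ N).flow t z k) ∂(localGibbsLaw σ a₀ u₀ θ₀ N (Φ N)) ≤
            ENNReal.ofReal C * ∫⁻ q, f q ∂(((volume : Measure T3).prod (gaussMeasure u θ)).prod
              (((volume : Measure T3).prod (gaussMeasure u θ)).prod ((volume : Measure T3).prod (gaussMeasure u θ))))))
    (hT34 : ∃ η₀ : ℝ, 0 < η₀ ∧ ∀ (a₀ θ₀ : T3 → ℝ) (u₀ : T3 → V3), Continuous a₀ → Continuous θ₀ → Continuous u₀ →
      (∀ x, 0 < a₀ x) → (∀ x, 0 < θ₀ x) → ∃ σ₀ : ℝ, 0 < σ₀ ∧ ∀ σ : ℝ, 0 < σ → σ < σ₀ →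
      ∀ Φ : (N : ℕ) → HardSphereFlow (Torus.geometry (Fin 3)) (hsDiameter σ N) (N + 1),
      ∀ τ : ℝ, 0 < τ → ∀ χ : ℝ × T3 → ℝ, Continuous χ → ∀ g : ℝ → ℝ, Continuous g →
      (∀ x, η₀ ≤ x → g x = 0) →
      ∀ η : ℝ, 0 < η → ∃ r₀ : ℝ, 0 < r₀ ∧ ∀ r : ℝ, 0 < r → r < r₀ →
      ∀ L : ℝ, 1 ≤ L → ∃ κ₀ : ℝ, 0 < κ₀ ∧ ∀ κ : ℝ, 0 < κ → κ < κ₀ → ∃ N₀ : ℕ, ∀ N : ℕ, N₀ ≤ N →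
        ∫ t in Set.Icc (0 : ℝ) τ,
            ∫ z, |evenTubeStat σ N χ g (fun q : V3 × V3 × V3 => speedCutoff L ‖q.2.2 - q.2.1‖) r κ t ((Φ N).flow t z)|
              ∂(localGibbsLaw σ a₀ u₀ θ₀ N (Φ N)) ≤ η) :
    ∃ η₀ : ℝ, 0 < η₀ ∧ ∀ (a₀ θ₀ : T3 → ℝ) (u₀ : T3 → V3), Continuous a₀ → Continuous θ₀ → Continuous u₀ →
      (∀ x, 0 < a₀ x) → (∀ x, 0 < θ₀ x) → ∃ σ₀ : ℝ, 0 < σ₀ ∧ ∀ σ : ℝ, 0 < σ → σ < σ₀ →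
      ∀ Φ : (N : ℕ) → HardSphereFlow (Torus.geometry (Fin 3)) (hsDiameter σ N) (N + 1),
      ∀ τ : ℝ, 0 < τ → ∀ χ : ℝ × T3 → ℝ, Continuous χ → ∀ g : ℝ → ℝ, Continuous g →
      (∀ a, η₀ ≤ a → g a = 0) →
      ∀ η δ : ℝ, 0 < η → 0 < δ → ∃ r₀ : ℝ, 0 < r₀ ∧ ∀ r : ℝ, 0 < r → r < r₀ →
      ∃ N₀ : ℕ, ∀ N : ℕ, N₀ ≤ N →
        localGibbsLaw σ a₀ u₀ θ₀ N (Φ N) {z | η < |evenStat σ N (Φ N) τ χ g (fun _ => 1) r z|}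
          ≤ ENNReal.ofReal δ := by
  -- the landed links of the chain
  have hF2 := stub_collisionMarkFluxLG_of_envelope hA
  have hF3 := stub_fwdHitFluxLG_of_envelope hA
  have hCMB : CollisionMomentBound :=
    Summit.AtomisticToContinuum.HydrodynamicLimit.Theorems.CollisionMomentBound.collisionMomentBound_of_collisionMarkFlux hF2
  have hT2b := stub_shortFlightDeficitLG_of_flux hF2 hF3
  have hT2 := stub_cylinderPullbackUnit_of_residuals (stub_continuityCorrectionLG hCMB hT2b) hT2b
    (stub_threeBodyCollisionSumLG_of_envelope hA)
  have hS6 := evenTubeStatRegular_one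
  obtain ⟨η₁, hη₁, H1⟩ := stub_unitMarkTruncation hCMB
  obtain ⟨η₂, hη₂, H2⟩ := hT2
  obtain ⟨η₃, hη₃, H3⟩ := hT34
  obtain ⟨η₆, hη₆, H6⟩ := hS6
  refine ⟨min (min η₁ η₂) (min η₃ η₆), lt_min (lt_min hη₁ hη₂) (lt_min hη₃ hη₆), ?_⟩
  intro a₀ θ₀ u₀ ha hθ hu ha0 hθ0
  obtain ⟨σ₁, hσ₁, H1⟩ := H1 a₀ θ₀ u₀ ha hθ hu ha0 hθ0
  obtain ⟨σ₂, hσ₂, H2⟩ := H2 a₀ θ₀ u₀ ha hθ hu ha0 hθ0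
  obtain ⟨σ₃, hσ₃, H3⟩ := H3 a₀ θ₀ u₀ ha hθ hu ha0 hθ0
  refine ⟨min (min σ₁ σ₂) (min σ₃ (1 / 2)), lt_min (lt_min hσ₁ hσ₂) (lt_min hσ₃ (by norm_num)), ?_⟩
  intro σ hσ hσlt Φ τ hτ χ hχ g hg hg0 η δ hη hδ
  have hσ1 : σ < σ₁ := lt_of_lt_of_le hσlt ((min_le_left _ _).trans (min_le_left _ _))
  have hσ2 : σ < σ₂ := lt_of_lt_of_le hσlt ((min_le_left _ _).trans (min_le_right _ _))
  have hσ3 : σ < σ₃ := lt_of_lt_of_le hσlt ((min_le_right _ _).trans (min_le_left _ _))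
  have hσhalf : σ ≤ 1 / 2 := (lt_of_lt_of_le hσlt ((min_le_right _ _).trans (min_le_right _ _))).le
  -- the cutoff vanishes above each threshold
  have hg1 : ∀ x, η₁ ≤ x → g x = 0 := fun x h => hg0 x (((min_le_left _ _).trans (min_le_left _ _)).trans h)
  have hg2 : ∀ x, η₂ ≤ x → g x = 0 := fun x h => hg0 x (((min_le_left _ _).trans (min_le_right _ _)).trans h)
  have hg3 : ∀ x, η₃ ≤ x → g x = 0 := fun x h => hg0 x (((min_le_right _ _).trans (min_le_left _ _)).trans h)
  have hg6 : ∀ x, η₆ ≤ x → g x = 0 := fun x h => hg0 x (((min_le_right _ _).trans (min_le_right _ _)).trans h)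
  -- accuracies
  have hη3 : 0 < η / 3 := by positivity
  have hδ3 : 0 < δ / 3 := by positivity
  have hm : 0 < η / 3 * (δ / 3) := by positivity
  obtain ⟨r₁, hr₁, H1⟩ := H1 σ hσ hσ1 Φ τ hτ χ hχ g hg hg1 (η / 3) (δ / 3) hη3 hδ3
  obtain ⟨r₂, hr₂, H2⟩ := H2 σ hσ hσ2 Φ τ hτ χ hχ g hg hg2 (η / 3) (δ / 3) hη3 hδ3
  obtain ⟨r₃, hr₃, H3⟩ := H3 σ hσ hσ3 Φ τ hτ χ hχ g hg hg3 (η / 3 * (δ / 3)) hm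
  refine ⟨min (min r₁ r₂) r₃, lt_min (lt_min hr₁ hr₂) hr₃, ?_⟩
  intro r hr hrlt
  have hr1 : r < r₁ := lt_of_lt_of_le hrlt ((min_le_left _ _).trans (min_le_left _ _))
  have hr2 : r < r₂ := lt_of_lt_of_le hrlt ((min_le_left _ _).trans (min_le_right _ _))
  have hr3 : r < r₃ := lt_of_lt_of_le hrlt (min_le_right _ _)
  -- truncation level (T1)
  obtain ⟨L₀, H1⟩ := H1 r hr hr1
  have hL₀ : L₀ ≤ max L₀ 1 := le_max_left _ _
  have hL1 : (1 : ℝ) ≤ max L₀ 1 := le_max_right _ _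
  have hLpos : (0 : ℝ) < max L₀ 1 := one_pos.trans_le hL1
  obtain ⟨N₁, H1⟩ := H1 (max L₀ 1) hL₀
  -- flight-time window (T2 and T34 each give a κ₀)
  obtain ⟨κ₂, hκ₂, H2⟩ := H2 r hr hr2 (max L₀ 1) hL1
  obtain ⟨κ₃, hκ₃, H3⟩ := H3 r hr hr3 (max L₀ 1) hL1
  have hκpos : (0 : ℝ) < min (κ₂ / 2) (κ₃ / 2) := lt_min (by positivity) (by positivity)
  have hκlt2 : min (κ₂ / 2) (κ₃ / 2) < κ₂ := lt_of_le_of_lt (min_le_left _ _) (by linarith)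
  have hκlt3 : min (κ₂ / 2) (κ₃ / 2) < κ₃ := lt_of_le_of_lt (min_le_right _ _) (by linarith)
  obtain ⟨N₂, H2⟩ := H2 (min (κ₂ / 2) (κ₃ / 2)) hκpos hκlt2
  obtain ⟨N₃, H3⟩ := H3 (min (κ₂ / 2) (κ₃ / 2)) hκpos hκlt3
  refine ⟨max N₁ (max N₂ N₃), fun N hN => ?_⟩
  have hN1 : N₁ ≤ N := (le_max_left _ _).trans hN
  have hN2 : N₂ ≤ N := ((le_max_left _ _).trans (le_max_right _ _)).trans hN
  have hN3 : N₃ ≤ N := ((le_max_right _ _).trans (le_max_right _ _)).trans hN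
  have E1 := H1 N hN1
  have E2 := H2 N hN2
  have E3 := H3 N hN3
  -- regularity of W (S6 at the unit mark) and the probability law, fed into the Markov step
  obtain ⟨hmeas, B, hB⟩ := H6 σ N χ g (max L₀ 1) r (min (κ₂ / 2) (κ₃ / 2)) τ hσ hχ hg hg6 hLpos hr hκpos.le
  have hPN : IsProbabilityMeasure (localGibbsLaw σ a₀ u₀ θ₀ N (Φ N)) :=
    isProbabilityMeasure_localGibbsLaw ha hθ hu ha0 hθ0 hσhalf N (Φ N)
  have E5 := measure_lt_abs_setIntegral_flow_le_of_l1 σ a₀ θ₀ u₀ N (Φ N)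
    (A := fun t z => evenTubeStat σ N χ g (fun q : V3 × V3 × V3 => speedCutoff (max L₀ 1) ‖q.2.2 - q.2.1‖) r
      (min (κ₂ / 2) (κ₃ / 2)) t z) hmeas hB hτ hη3 E3
  have hval : η / 3 * (δ / 3) / (η / 3) = δ / 3 := by
    field_simp
  rw [hval] at E5
  -- the union bound
  set P := localGibbsLaw σ a₀ u₀ θ₀ N (Φ N) with hP
  set D := fun z => evenStat σ N (Φ N) τ χ g (fun _ => 1) r z with hD
  set DL := fun z => evenStat σ N (Φ N) τ χ g (fun q : V3 × V3 × V3 => speedCutoff (max L₀ 1) ‖q.2.2 - q.2.1‖) r z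
    with hDL
  set T := fun z => evenTubeTimeStat σ N (Φ N) τ χ g (fun q : V3 × V3 × V3 => speedCutoff (max L₀ 1) ‖q.2.2 - q.2.1‖) r
    (min (κ₂ / 2) (κ₃ / 2)) z with hT
  have E5' : P {z | η / 3 < |T z|} ≤ ENNReal.ofReal (δ / 3) := E5
  have hsub : {z | η < |D z|} ⊆
      ({z | η / 3 < |D z - DL z|} ∪ {z | η / 3 < |DL z - T z|}) ∪ {z | η / 3 < |T z|} := by
    intro z hz
    simp only [Set.mem_setOf_eq, Set.mem_union] at hz ⊢
    by_contra hcon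
    simp only [not_or, not_lt] at hcon
    obtain ⟨⟨h1, h2⟩, h3⟩ := hcon
    have i1 := abs_sub_abs_le_abs_sub (D z) (DL z)
    have i2 := abs_sub_abs_le_abs_sub (DL z) (T z)
    linarith
  calc P {z | η < |D z|}
      ≤ P (({z | η / 3 < |D z - DL z|} ∪ {z | η / 3 < |DL z - T z|}) ∪ {z | η / 3 < |T z|}) :=
        measure_mono hsub
    _ ≤ P ({z | η / 3 < |D z - DL z|} ∪ {z | η / 3 < |DL z - T z|}) + P {z | η / 3 < |T z|} :=
        measure_union_le _ _
    _ ≤ (P {z | η / 3 < |D z - DL z|} + P {z | η / 3 < |DL z - T z|}) + P {z | η / 3 < |T z|} :=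
        add_le_add (measure_union_le _ _) le_rfl
    _ ≤ (ENNReal.ofReal (δ / 3) + ENNReal.ofReal (δ / 3)) + ENNReal.ofReal (δ / 3) :=
        add_le_add (add_le_add E1 E2) E5'
    _ = ENNReal.ofReal δ := by
        rw [← ENNReal.ofReal_add hδ3.le hδ3.le, ← ENNReal.ofReal_add (by positivity) hδ3.le]
        congr 1
        ring

/-- **`CollisionRate ⇐ (A) ∧ T34`.**  The crux `InformationPercolationEngine.CollisionRate` (stmt-AtomisticToContinuum-13481: the
Enskog collision-frequency law `K_N[χ g(σ³ρ_r)] − σ³∫₀^τ∫ χ g Y(σ³ρ_r) B¹_r → 0` in probability under local Gibbs data, `N → ∞` then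
`r → 0`) follows from the marginal envelope (A) of the evolved law and the two-body local-equilibrium statement T34 — through
`evenStatOne_of_marginalEnvelope_of_evenTubeStatL1` and the bridge `collisionRate_of_evenStat_one`.  Both hypotheses are OPEN
(a-priori class / Boltzmann–Enskog class); this theorem records that the crux is exactly as hard as their conjunction.  Name and
header are those of the registered stub RED `stub_collisionRateReduction` of the line's skeleton v23. [folklore] -/
theorem stub_collisionRateReduction :
    (∀ (a₀ θ₀ : T3 → ℝ) (u₀ : T3 → V3), Continuous a₀ → Continuous θ₀ → Continuous u₀ →
      (∀ x, 0 < a₀ x) → (∀ x, 0 < θ₀ x) → ∃ σ₀ : ℝ, 0 < σ₀ ∧ ∀ σ : ℝ, 0 < σ → σ < σ₀ →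
      ∀ Φ : (N : ℕ) → HardSphereFlow (Torus.geometry (Fin 3)) (hsDiameter σ N) (N + 1),
      ∀ τ : ℝ, 0 < τ → ∃ C : ℝ, 0 ≤ C ∧ ∃ u : V3, ∃ θ : ℝ, 0 < θ ∧ ∃ N₀ : ℕ, ∀ N : ℕ, N₀ ≤ N →
      ∀ t ∈ Set.Icc (0 : ℝ) τ,
        (∀ i j : Fin (N + 1), i ≠ j → ∀ f : (T3 × V3) × (T3 × V3) → ℝ≥0∞, Measurable f →
          ∫⁻ z, f ((Φ N).flow t z i, (Φ N).flow t z j) ∂(localGibbsLaw σ a₀ u₀ θ₀ N (Φ N)) ≤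
            ENNReal.ofReal C * ∫⁻ q, f q ∂(((volume : Measure T3).prod (gaussMeasure u θ)).prod
              ((volume : Measure T3).prod (gaussMeasure u θ)))) ∧
        (∀ i j k : Fin (N + 1), i ≠ j → i ≠ k → j ≠ k → ∀ f : (T3 × V3) × (T3 × V3) × (T3 × V3) → ℝ≥0∞, Measurable f →
          ∫⁻ z, f ((Φ N).flow t z i, (Φ N).flow t z j, (Φ N).flow t z k) ∂(localGibbsLaw σ a₀ u₀ θ₀ N (Φ N)) ≤
            ENNReal.ofReal C * ∫⁻ q, f q ∂(((volume : Measure T3).prod (gaussMeasure u θ)).prod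
              (((volume : Measure T3).prod (gaussMeasure u θ)).prod ((volume : Measure T3).prod (gaussMeasure u θ)))))) →
    (∃ η₀ : ℝ, 0 < η₀ ∧ ∀ (a₀ θ₀ : T3 → ℝ) (u₀ : T3 → V3), Continuous a₀ → Continuous θ₀ → Continuous u₀ →
      (∀ x, 0 < a₀ x) → (∀ x, 0 < θ₀ x) → ∃ σ₀ : ℝ, 0 < σ₀ ∧ ∀ σ : ℝ, 0 < σ → σ < σ₀ →
      ∀ Φ : (N : ℕ) → HardSphereFlow (Torus.geometry (Fin 3)) (hsDiameter σ N) (N + 1),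
      ∀ τ : ℝ, 0 < τ → ∀ χ : ℝ × T3 → ℝ, Continuous χ → ∀ g : ℝ → ℝ, Continuous g →
      (∀ x, η₀ ≤ x → g x = 0) →
      ∀ η : ℝ, 0 < η → ∃ r₀ : ℝ, 0 < r₀ ∧ ∀ r : ℝ, 0 < r → r < r₀ →
      ∀ L : ℝ, 1 ≤ L → ∃ κ₀ : ℝ, 0 < κ₀ ∧ ∀ κ : ℝ, 0 < κ → κ < κ₀ → ∃ N₀ : ℕ, ∀ N : ℕ, N₀ ≤ N →
        ∫ t in Set.Icc (0 : ℝ) τ,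
            ∫ z, |evenTubeStat σ N χ g (fun q : V3 × V3 × V3 => speedCutoff L ‖q.2.2 - q.2.1‖) r κ t ((Φ N).flow t z)|
              ∂(localGibbsLaw σ a₀ u₀ θ₀ N (Φ N)) ≤ η) →
    CollisionRate :=
  fun hA hT34 => collisionRate_of_evenStat_one (evenStatOne_of_marginalEnvelope_of_evenTubeStatL1 hA hT34)

end

end Summit.AtomisticToContinuum.HydrodynamicLimit.Theorems.CollisionRate
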